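import Summits.ResolutionOfSingularities.ResolutionOfSingularities.Theorems.WeightedInvariantSuccessorRatioBoundContact
import Summits.ResolutionOfSingularities.ResolutionOfSingularities.Theorems.WeightedInvariantContactCentreFiltrationRegular
import Literature.AlgebraicGeometry.Resolution.BlowupRingExceptionalFibre
import Mathlib.Algebra.Order.Floor.Div
import HarnessLib

/-!
# P3c≤3 EXISTENCE, step (EX-1)/(EX-2): THE RATIONAL ONE-FLAG SLOPE IS ATTAINED, hence the σ-RATIO of a two-flag maximiser EXISTS
# (door `HypersurfaceCentreConstruction`, stmt-ResolutionOfSingularities-19897; P3 rung, obligation (o70-a) `SigmaMaximiserExistsLE3Body`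
# of res-L1-w43-plan-1's SPEC (Δ12) `JSigmaCanon_sketch.lean`; hand res-D-pv-038)

Topic: `Summits/ResolutionOfSingularities/ResolutionOfSingularities/Theorems`. Helper for the door item `HypersurfaceCentreConstruction`
(stmt-ResolutionOfSingularities-19897, route `WeightedInvariant`), line `local-engine` (L W4.3), def-free.  The point rule of record
`Iota3.jSigmaPt` is a sup over the σ-ATTAINING two-flags of `f` — the flags whose admissible weight triple `(q ; r₁, r₂)` is lexicographically
maximal in (RATIO `r₁/r₂`, LEVEL `r₁/q`) among all reached triples (`Iota3.IsSigmaMaximiser`, res-type-061 p529577).  Their EXISTENCE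
(obligation (EX) = (o70-a)) is a maximum over an INFINITE set; this file settles its FIRST coordinate:

* §1 `ratContactFiltration_level_le_contactFiltration` — a rational one-flag slope `a/b ≥ B` (`B` an integer) at level `aν` forces the integer
  contact level `B`: `ratContactFiltration g a b (aν) ≤ contactFiltration g B (Bν)`; hence (`slope_lt_bMax_succ`) every reached slope is
  `< bMax f + 1` at a position NOT of monomial type of an EXCELLENT regular local ring (res-type-092's `le_bMax_of_reaches`, K6).
* §2 `ratContactFiltration_level_eq_of_ceilDiv_eq` + `exists_ceilDiv_eq_of_denom_le` — DISCRETENESS: membership of `f` in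
  `ratContactFiltration g a b (aν)` depends on `(a, b)` only through the integer vector `(⌈j·a/b⌉)_{j ≤ ν}`, and every slope `a/b` is dominated
  by a slope `a'/b'` WITH THE SAME VECTOR and `b' ≤ ν` (take `a'/b' = min_j ⌈j a/b⌉ / j`: left-continuity of the ceilings).  So the reached
  slopes with denominator `≤ ν` dominate all reached slopes, and they form a FINITE set.
* §3 **`exists_ratSlope_max`** — (EX-1)+(EX-2), one-flag form: at a position `0 ≠ f ∈ 𝔪²` not of monomial type of an excellent regular local
  ring there are a regular parameter `g` and `a/b ≥ 1` with `f ∈ ratContactFiltration g a b (aν)` such that EVERY reached slope `a'/b'` (any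
  parameter) satisfies `a'/b' ≤ a/b` — the rational refinement of res-type-092's `one_le_bMax_and_reaches`.
* §4 **`exists_flagReaches_ratio_max`** — (EX-2), two-flag form, dimension `3`: some admissible triple `(b ; a, b)` is REACHED by a two-flag
  and its ratio `a/b` bounds the ratio `r₁/r₂` of every reached admissible triple (res-L1-w43-idea-2's one-flag collapse,
  `RatContact.FlagReaches.oneFlagReaches` / `flagReaches_of_mem_ratContactFiltration`, tree p560066) — the RATIO half of a σ-maximiser.
  The LEVEL half ((EX-3) per flag, (EX-4) across flags) is NOT here.

[OURS · L1 W4.3 · (o70-a) steps (EX-1)(EX-2)]  Replaces the role of NO printed item; NOT a statement of the manuscript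
[claim: Hironaka2017, status: under-review]. AI work, weaker than expert review.  Pure commutative algebra; no named facts.

## References

* H. Hironaka, *Characteristic polyhedra of singularities*, J. Math. Kyoto Univ. 7 (1967), §1 (the first slope `δ`). [Hironaka1967]
* V. Cossart, U. Jannsen, S. Saito, *Desingularization: invariants and strategy*, LNM 2270 (2020), Ch. 8 (`δ` via the polyhedron).
  [CossartJannsenSaito2020]
* res-L1-w43-plan-1, SPEC (Δ12) `JSigmaCanon_sketch.lean` aceffaa8e08fb006 (OURS, AI planning); res-L1-w43-idea-2, Sketch-R9 §2 (one-flag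
  collapse), ported by res-L1-type-o4 (p560066) (OURS, AI work).
-/

noncomputable section

open IsLocalRing Literature.AlgebraicGeometry.Resolution
open Summit.ResolutionOfSingularities.ResolutionOfSingularities.Theorems

set_option linter.dupNamespace false -- mandated namespace of this single-conjunct summit

namespace Summit.ResolutionOfSingularities.ResolutionOfSingularities.Cruxes.HypersurfaceCentreConstruction.LocalEngine

namespace Iota3

namespace RatContact

variable {S : Type} [CommRing S]

/-! ## §1 A rational slope `≥ B` forces the integer contact level `B` -/

/-- `⌈a j / b⌉ ≥ B j` when `B b ≤ a`. [folklore] -/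
theorem mul_le_ceilDiv_of_mul_le {a b B : ℕ} (hb : 0 < b) (hB : B * b ≤ a) (j : ℕ) : B * j ≤ (a * j) ⌈/⌉ b := by
  by_contra hlt
  have hle : (a * j) ⌈/⌉ b ≤ B * j - 1 := by omega
  rw [ceilDiv_le_iff_le_smul hb, smul_eq_mul] at hle
  -- `a j ≤ b (B j - 1)` contradicts `B b j ≤ a j` unless `B j = 0`
  rcases Nat.eq_zero_or_pos (B * j) with h0 | hpos
  · exact hlt (h0 ▸ Nat.zero_le _)
  · have h1 : B * b * j ≤ a * j := Nat.mul_le_mul_right j hB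
    have h2 : b * (B * j - 1) + b = b * (B * j) := by
      rw [← Nat.mul_succ, Nat.succ_eq_add_one, Nat.sub_add_cancel hpos]
    have h3 : a * j + b ≤ b * (B * j) := by rw [← h2]; omega
    have h4 : b * (B * j) = B * b * j := by ring
    omega

/-- **A rational one-flag slope `a/b ≥ B` at level `aν` lies inside the integer contact filtration of weight `B` at level `Bν`.**
[OURS · L1 W4.3 · (EX-1)] -/
theorem ratContactFiltration_level_le_contactFiltration [IsLocalRing S] (g : S) {a b B : ℕ} (hb : 0 < b) (hB : B * b ≤ a) (ν : ℕ) :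
    ratContactFiltration g a b (a * ν) ≤ contactFiltration g B (B * ν) := by
  rw [ratContactFiltration_def, contactFiltration_def]
  refine iSup_le fun α => le_iSup_of_le α (Ideal.mul_mono_right (Ideal.pow_le_pow_right ?_))
  rw [← mul_tsub, ← mul_tsub, ← Nat.ceilDiv_eq_add_pred_div]
  exact mul_le_ceilDiv_of_mul_le hb hB (ν - α)

/-- **Every reached rational slope is `< bMax f + 1`** at a position `0 ≠ f ∈ 𝔪²` NOT of monomial type of an EXCELLENT regular local
ring: a slope `a/b ≥ bMax f + 1` would reach the integer level `bMax f + 1` (res-type-092's `le_bMax_of_reaches`, K6). [OURS · L1 W4.3 · (EX-1)] -/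
theorem slope_lt_bMax_succ [IsRegularLocalRing S] (hS : IsExcellentRing S) {f : S} (hf0 : f ≠ 0) (hf2 : f ∈ maximalIdeal S ^ 2)
    (hnm : ¬ IsMonomialType f) {g : S} (hg : g ∈ maximalIdeal S) (hg2 : g ∉ maximalIdeal S ^ 2) {a b : ℕ} (hb : 0 < b)
    (hmem : f ∈ ratContactFiltration g a b (a * (adicOrder f).toNat)) : a < (bMax f + 1) * b := by
  by_contra hle
  rw [not_lt] at hle
  have hreach : Reaches f (adicOrder f).toNat (bMax f + 1) :=
    ⟨g, hg, hg2, ratContactFiltration_level_le_contactFiltration g hb hle _ hmem⟩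
  have h := le_bMax_of_reaches S hS hf0 hf2 hnm (by omega) hreach
  omega

/-! ## §2 Discreteness: the membership depends on `(⌈j a/b⌉)_{j ≤ ν}` only, and small denominators dominate -/

/-- **The level-`aν` membership depends on the slope only through the ceilings `⌈j a / b⌉`, `j ≤ ν`.** [OURS · L1 W4.3 · (EX-1)] -/
theorem ratContactFiltration_level_eq_of_ceilDiv_eq [IsLocalRing S] (g : S) {a b a' b' ν : ℕ}
    (h : ∀ j ≤ ν, (a' * j) ⌈/⌉ b' = (a * j) ⌈/⌉ b) :
    ratContactFiltration g a' b' (a' * ν) = ratContactFiltration g a b (a * ν) := by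
  rw [ratContactFiltration_def, ratContactFiltration_def]
  refine iSup_congr fun α => ?_
  rw [← mul_tsub, ← mul_tsub, ← Nat.ceilDiv_eq_add_pred_div, ← Nat.ceilDiv_eq_add_pred_div, h (ν - α) (Nat.sub_le ν α)]

/-- `a ≤ b ⌈a/b⌉`. [folklore] -/
theorem le_mul_ceilDiv {a b : ℕ} (hb : 0 < b) : a ≤ b * (a ⌈/⌉ b) := by
  have h : a ⌈/⌉ b ≤ a ⌈/⌉ b := le_rfl
  rwa [ceilDiv_le_iff_le_smul hb, smul_eq_mul] at h

/-- **Small denominators dominate** (left-continuity of the ceilings): for `0 < b` and `0 < ν` there is a slope `a'/b' ≥ a/b` with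
`b' ≤ ν` and the SAME ceiling vector `(⌈j a'/b'⌉)_{j ≤ ν} = (⌈j a/b⌉)_{j ≤ ν}` — namely `a'/b' = min_{1 ≤ j ≤ ν} ⌈j a/b⌉ / j`.
[OURS · L1 W4.3 · (EX-1)] -/
theorem exists_ceilDiv_eq_of_denom_le {a b ν : ℕ} (hb : 0 < b) (hν : 0 < ν) :
    ∃ a' b' : ℕ, 0 < b' ∧ b' ≤ ν ∧ a * b' ≤ a' * b ∧ ∀ j ≤ ν, (a' * j) ⌈/⌉ b' = (a * j) ⌈/⌉ b := by
  classical
  -- the minimiser `j₀` of `⌈j a/b⌉ / j` over `1 ≤ j ≤ ν`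
  have hne : (Finset.Icc 1 ν).Nonempty := ⟨1, Finset.mem_Icc.mpr ⟨le_rfl, hν⟩⟩
  obtain ⟨j₀, hj₀, hmin⟩ := Finset.exists_min_image (Finset.Icc 1 ν) (fun j => (((a * j) ⌈/⌉ b : ℕ) : ℚ) / j) hne
  obtain ⟨hj₀1, hj₀ν⟩ := Finset.mem_Icc.mp hj₀
  refine ⟨(a * j₀) ⌈/⌉ b, j₀, hj₀1, hj₀ν, ?_, fun j hj => ?_⟩
  · -- `a j₀ ≤ b ⌈a j₀ / b⌉`
    rw [mul_comm ((a * j₀) ⌈/⌉ b) b]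
    exact le_mul_ceilDiv hb
  · rcases Nat.eq_zero_or_pos j with rfl | hjpos
    · -- `j = 0`: both ceilings vanish
      have h0 : ∀ c : ℕ, 0 < c → (0 : ℕ) ⌈/⌉ c = 0 := fun c hc =>
        Nat.le_zero.mp ((ceilDiv_le_iff_le_smul hc).mpr (Nat.zero_le _))
      rw [mul_zero, mul_zero, h0 _ hj₀1, h0 _ hb]
    · have hjmem : j ∈ Finset.Icc 1 ν := Finset.mem_Icc.mpr ⟨hjpos, hj⟩
      apply le_antisymm
      · -- `≤`: minimality of `j₀`
        rw [ceilDiv_le_iff_le_smul hj₀1, smul_eq_mul]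
        have hq := hmin j hjmem
        rw [div_le_div_iff₀ (by exact_mod_cast hj₀1) (by exact_mod_cast hjpos)] at hq
        have hq' : ((a * j₀) ⌈/⌉ b) * j ≤ ((a * j) ⌈/⌉ b) * j₀ := by exact_mod_cast hq
        calc (a * j₀) ⌈/⌉ b * j ≤ (a * j) ⌈/⌉ b * j₀ := hq'
          _ = j₀ * ((a * j) ⌈/⌉ b) := mul_comm _ _
      · -- `≥`: `a/b ≤ ⌈a j₀/b⌉ / j₀`
        rw [ceilDiv_le_iff_le_smul hb, smul_eq_mul]
        -- from `(a j₀ ⌈/⌉ b) j ≤ j₀ d` and `a j₀ ≤ b (a j₀ ⌈/⌉ b)` deduce `a j ≤ b d`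
        have h1 : (a * j₀) ⌈/⌉ b * j ≤ j₀ * (((a * j₀) ⌈/⌉ b * j) ⌈/⌉ j₀) := by
          have h := le_mul_ceilDiv (a := (a * j₀) ⌈/⌉ b * j) hj₀1
          exact h
        have h2 : a * j₀ ≤ b * ((a * j₀) ⌈/⌉ b) := le_mul_ceilDiv hb
        have h3 : a * j₀ * j ≤ b * (j₀ * (((a * j₀) ⌈/⌉ b * j) ⌈/⌉ j₀)) :=
          (Nat.mul_le_mul_right j h2).trans (by rw [mul_assoc]; exact Nat.mul_le_mul_left b h1)
        have h4 : j₀ * (a * j) ≤ j₀ * (b * (((a * j₀) ⌈/⌉ b * j) ⌈/⌉ j₀)) := by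
          calc j₀ * (a * j) = a * j₀ * j := by ring
            _ ≤ b * (j₀ * (((a * j₀) ⌈/⌉ b * j) ⌈/⌉ j₀)) := h3
            _ = j₀ * (b * (((a * j₀) ⌈/⌉ b * j) ⌈/⌉ j₀)) := by ring
        exact Nat.le_of_mul_le_mul_left h4 hj₀1

/-! ## §3 The maximal rational one-flag slope exists -/

/-- **(EX-1)+(EX-2), one-flag form: THE MAXIMAL RATIONAL ONE-FLAG SLOPE IS ATTAINED.**  `S` an excellent regular local ring, `0 ≠ f ∈ 𝔪²`
NOT of monomial type, `ν = ord f`.  There are a regular parameter `g ∈ 𝔪 ∖ 𝔪²` and a slope `a/b ≥ 1` (`0 < b ≤ a`) with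
`f ∈ ratContactFiltration g a b (aν)` such that for every regular parameter `g'` and every `(a', b')`, `0 < b'`, with
`f ∈ ratContactFiltration g' a' b' (a'ν)`: `a' b ≤ a b'` (i.e. `a'/b' ≤ a/b`).  (Slopes are `< bMax f + 1`; the reached slopes with denominator
`≤ ν` dominate all reached slopes and form a finite set.) [OURS · L1 W4.3 · (o70-a) (EX-1)(EX-2)] -/
theorem exists_ratSlope_max [IsRegularLocalRing S] (hS : IsExcellentRing S) {f : S} (hf0 : f ≠ 0) (hf2 : f ∈ maximalIdeal S ^ 2)
    (hnm : ¬ IsMonomialType f) :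
    ∃ (g : S) (a b : ℕ), g ∈ maximalIdeal S ∧ g ∉ maximalIdeal S ^ 2 ∧ 0 < b ∧ b ≤ a ∧
      f ∈ ratContactFiltration g a b (a * (adicOrder f).toNat) ∧
      ∀ (g' : S) (a' b' : ℕ), g' ∈ maximalIdeal S → g' ∉ maximalIdeal S ^ 2 → 0 < b' →
        f ∈ ratContactFiltration g' a' b' (a' * (adicOrder f).toNat) → a' * b ≤ a * b' := by
  classical
  -- a regular parameter and the order `ν ≥ 1`
  have h𝔪 : maximalIdeal S ≠ ⊥ := by
    intro h
    apply hf0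
    have : f ∈ maximalIdeal S := Ideal.pow_le_self two_ne_zero hf2
    rw [h] at this
    exact (Submodule.mem_bot S).mp this
  have hpar := exists_mem_maximalIdeal_not_mem_sq h𝔪
  obtain ⟨ν, -, hνeq, hν1, hfν, -⟩ := exists_adicOrder_eq_of_not_isMonomialType hf0 hnm hpar
  rw [hνeq]
  obtain ⟨g₀, hg₀, hg₀2⟩ := hpar
  -- the finite dominating set of reached slopes with denominator `≤ ν`
  set P : Set (ℕ × ℕ) := {p | 0 < p.2 ∧ p.2 ≤ ν ∧ p.1 < (bMax f + 1) * ν ∧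
      ∃ g : S, g ∈ maximalIdeal S ∧ g ∉ maximalIdeal S ^ 2 ∧ f ∈ ratContactFiltration g p.1 p.2 (p.1 * ν)} with hP
  have hPfin : P.Finite := by
    refine (Set.finite_Iio ((bMax f + 1) * ν)).prod (Set.finite_Iic ν) |>.subset ?_
    rintro ⟨x, y⟩ ⟨-, hy, hx, -⟩
    exact ⟨hx, hy⟩
  -- `(1, 1)` is reached by `g₀`: `ratContactFiltration g₀ 1 1 ν = contactFiltration g₀ 1 ν ⊇ 𝔪^ν`
  have hreach11 : f ∈ ratContactFiltration g₀ 1 1 (1 * ν) := by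
    have hle : contactFiltration g₀ 1 (1 * ν) ≤ ratContactFiltration g₀ 1 1 (1 * ν) := by
      rw [ratContactFiltration_def, contactFiltration_def]
      refine iSup_le fun α => le_iSup_of_le α (le_of_eq ?_)
      congr 2
      omega
    exact hle (pow_le_contactFiltration g₀ 1 _ (by rw [one_mul]; exact hfν))
  -- every reached slope is dominated by a member of `P`
  have hdom : ∀ (g' : S) (a' b' : ℕ), g' ∈ maximalIdeal S → g' ∉ maximalIdeal S ^ 2 → 0 < b' →
      f ∈ ratContactFiltration g' a' b' (a' * ν) → ∃ p ∈ P, a' * p.2 ≤ p.1 * b' := by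
    intro g' a' b' hg' hg'2 hb' hmem
    obtain ⟨a'', b'', hb'', hb''ν, hdom, hvec⟩ := exists_ceilDiv_eq_of_denom_le (a := a') hb' hν1
    have hmem'' : f ∈ ratContactFiltration g' a'' b'' (a'' * ν) := by
      rw [ratContactFiltration_level_eq_of_ceilDiv_eq g' hvec]; exact hmem
    have hlt : a'' < (bMax f + 1) * ν := by
      have h := slope_lt_bMax_succ hS hf0 hf2 hnm hg' hg'2 hb'' (by rw [hνeq]; exact hmem'')
      calc a'' < (bMax f + 1) * b'' := h
        _ ≤ (bMax f + 1) * ν := Nat.mul_le_mul_left _ hb''ν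
    exact ⟨(a'', b''), ⟨hb'', hb''ν, hlt, g', hg', hg'2, hmem''⟩, hdom⟩
  -- `P` is non-empty: it contains the dominator of `(1, 1)`
  obtain ⟨p₁, hp₁P, -⟩ := hdom g₀ 1 1 hg₀ hg₀2 Nat.one_pos hreach11
  have hPne : hPfin.toFinset.Nonempty := ⟨p₁, hPfin.mem_toFinset.mpr hp₁P⟩
  -- a member of `P` with maximal slope
  obtain ⟨p, hpP, hmax⟩ := Finset.exists_max_image hPfin.toFinset (fun p : ℕ × ℕ => ((p.1 : ℕ) : ℚ) / p.2) hPne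
  obtain ⟨hpb, -, -, g, hg, hg2, hmemp⟩ := hPfin.mem_toFinset.mp hpP
  have key : ∀ (g' : S) (a' b' : ℕ), g' ∈ maximalIdeal S → g' ∉ maximalIdeal S ^ 2 → 0 < b' →
      f ∈ ratContactFiltration g' a' b' (a' * ν) → a' * p.2 ≤ p.1 * b' := by
    intro g' a' b' hg' hg'2 hb' hmem
    obtain ⟨p', hp'P, hdom'⟩ := hdom g' a' b' hg' hg'2 hb' hmem
    have hp'b : 0 < p'.2 := hp'P.1
    have h1 := hmax p' (hPfin.mem_toFinset.mpr hp'P)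
    rw [div_le_div_iff₀ (by exact_mod_cast hp'b) (by exact_mod_cast hpb)] at h1
    have h1' : p'.1 * p.2 ≤ p.1 * p'.2 := by exact_mod_cast h1
    -- `a'/b' ≤ p'.1/p'.2 ≤ p.1/p.2`
    have h2 : a' * p.2 * p'.2 ≤ p.1 * b' * p'.2 := by
      calc a' * p.2 * p'.2 = a' * p'.2 * p.2 := by ring
        _ ≤ p'.1 * b' * p.2 := Nat.mul_le_mul_right _ hdom'
        _ = p'.1 * p.2 * b' := by ring
        _ ≤ p.1 * p'.2 * b' := Nat.mul_le_mul_right _ h1'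
        _ = p.1 * b' * p'.2 := by ring
    exact Nat.le_of_mul_le_mul_right h2 hp'b
  refine ⟨g, p.1, p.2, hg, hg2, hpb, ?_, hmemp, key⟩
  -- `1 ≤ p.1/p.2` from the reached slope `(1, 1)`
  have h := key g₀ 1 1 hg₀ hg₀2 Nat.one_pos hreach11
  simpa using h

/-- The same over a field: a regular local ring ESSENTIALLY OF FINITE TYPE over a field is excellent (tree `IsExcellentRing.of_essFiniteType`).
[OURS · L1 W4.3 · (o70-a) (EX-1)(EX-2)] -/
theorem exists_ratSlope_max_of_essFiniteType (k₀ : Type) [Field k₀] [IsRegularLocalRing S] [Algebra k₀ S] [Algebra.EssFiniteType k₀ S]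
    {f : S} (hf0 : f ≠ 0) (hf2 : f ∈ maximalIdeal S ^ 2) (hnm : ¬ IsMonomialType f) :
    ∃ (g : S) (a b : ℕ), g ∈ maximalIdeal S ∧ g ∉ maximalIdeal S ^ 2 ∧ 0 < b ∧ b ≤ a ∧
      f ∈ ratContactFiltration g a b (a * (adicOrder f).toNat) ∧
      ∀ (g' : S) (a' b' : ℕ), g' ∈ maximalIdeal S → g' ∉ maximalIdeal S ^ 2 → 0 < b' →
        f ∈ ratContactFiltration g' a' b' (a' * (adicOrder f).toNat) → a' * b ≤ a * b' :=
  have hk : IsExcellentRing k₀ := Stacks07QW_field_holds k₀ k₀ inferInstance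
  exists_ratSlope_max (hk.of_essFiniteType ‹_›) hf0 hf2 hnm

/-! ## §4 The σ-RATIO of a two-flag maximiser exists (dimension three) -/

/-- **(EX-2), two-flag form: A REACHED ADMISSIBLE TRIPLE OF MAXIMAL RATIO EXISTS** in a regular local ring of dimension `3`, excellent, at a
position `0 ≠ f ∈ 𝔪²` not of monomial type: some admissible `(b ; a, b)` is reached by a two-flag (`Iota3.FlagReaches`), and every reached
admissible `(q' ; r₁', r₂')` has `r₁' b ≤ a r₂'` — the first lex condition of `Iota3.IsSigmaMaximiser`.  (One-flag collapse of
res-L1-w43-idea-2: reached ratios are reached one-flag slopes and conversely.) [OURS · L1 W4.3 · (o70-a) (EX-2)] -/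
theorem exists_flagReaches_ratio_max [IsRegularLocalRing S] (hS : IsExcellentRing S) (hdim : ringKrullDim S = 3) {f : S} (hf0 : f ≠ 0)
    (hf2 : f ∈ maximalIdeal S ^ 2) (hnm : ¬ IsMonomialType f) :
    ∃ (g₁ g₂ : S) (a b : ℕ), AdmissibleTriple b a b ∧ IsTwoFlag g₁ g₂ ∧
      f ∈ flagContactFiltration g₁ g₂ b a b (a * (adicOrder f).toNat) ∧
      ∀ q' r₁' r₂' : ℕ, AdmissibleTriple q' r₁' r₂' → FlagReaches f (adicOrder f).toNat q' r₁' r₂' → r₁' * b ≤ a * r₂' := by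
  obtain ⟨g, a, b, hg, hg2, hb, hba, hmem, hmax⟩ := exists_ratSlope_max hS hf0 hf2 hnm
  -- a two-flag partner of `g`: complete `g` to a regular system of parameters
  have hd : (maximalIdeal S).spanFinrank = 3 := spanFinrank_eq_three_of_ringKrullDim hdim
  obtain ⟨z, hz, hz0⟩ := exists_rsop_apply_eq hd hg hg2 (0 : Fin 3)
  have hfl : IsTwoFlag (z 0) (z 1) := isTwoFlag_of_rsp hd z hz (by decide)
  rw [hz0] at hfl
  refine ⟨g, z 1, a, b, ⟨hb, le_rfl, hba⟩, hfl, ratContactFiltration_le_flagContactFiltration g (z 1) a b _ hmem,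
    fun q' r₁' r₂' hadm hreach => ?_⟩
  obtain ⟨g', hg', hg'2, hmem'⟩ := FlagReaches.oneFlagReaches hadm hreach
  exact hmax g' r₁' r₂' hg' hg'2 (lt_of_lt_of_le hadm.1 hadm.2.1) hmem'

end RatContact

end Iota3

end Summit.ResolutionOfSingularities.ResolutionOfSingularities.Cruxes.HypersurfaceCentreConstruction.LocalEngine

end
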